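import Summits.QuantumFields.YangMills.Theorems.ToronSmallBallOwnAxisShiftJacobian
import HarnessLib

/-!
# The own-axis sheet shift: domination of a sector event by its shifted image (translate lemma with a Jacobian)

Support module (`--supports` stmt-QuantumFields-24089, `ToronSmallBall.PeriodicOffCoreStripWindowDeep`; seat ym-dw-p1 g15).  The tree's translate lemma
`TT.sectorWeight_indicator_le_of_translate` needs a MEASURE-PRESERVING slice map; the own-axis sheet shift `Ψ(g, U⃗) = (g, (ownShift θ U_t)_t)` is not
measure preserving, but on the event that every plane line holonomy of every slice lies in the chart shell `exp(ι{a ≤ ‖x‖ ≤ b})` it has the Jacobian bound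
`(ρ^{#plane})^{n+1}` (`OwnAxis.lintegral_shell_prod_mul_comp_ownShift_slices_le`).  We prove the corresponding domination:

★ `sectorWeight_indicator_le_of_ownShift`: if the measurable event `A ⊆ (seam field) × (slices)` lies in that shell event, `Ψ(A) ⊆ B`, and the sector
density satisfies `w_z(U⃗, g) ≤ C · w_z(Ψ(U⃗), g)` on `A` (`C ≥ 0`; module `ToronSmallBallOwnAxisShiftCost` for `z = 0`), then
`sectorWeight β n z 𝟙_A ≤ C · (ρ^{#plane})^{n+1} · sectorWeight β n z 𝟙_B`.
(Bochner ↔ lower Lebesgue integral conversion around the Jacobian inequality.)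

HONEST FRAMING: a change-of-variables inequality on a finite product of compact groups; nothing about infinite volume, the continuum limit or the Clay
gap.  No `sorry`, no new axiom, no new definition.  References: [cite: Luscher1983, §2]; [cite: MontvayMunster1994, (3.145)].
-/

set_option autoImplicit false

noncomputable section

open MeasureTheory Set Function
open scoped ENNReal BigOperators
open Literature.MathematicalPhysics.QuantumFieldTheory
open Literature.MathematicalPhysics.QuantumLattice
open Literature.MathematicalPhysics.QuantumFieldTheory.Balaban1983to89.T4HaarSU2ExpChart (expPoint)

namespace Summit.QuantumFields.YangMills.Theorems.FemtoTransferGap.OwnAxis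

open ClassShift
open Summit.QuantumFields.YangMills.Theorems.FemtoTransferGap.TT

variable {L : ℕ} [NeZero L]

/-- A Bochner comparison from a lower-Lebesgue one: for measurable `f, g ≥ 0` with `g` integrable and `∫⁻ f ≤ c ∫⁻ g` (`c` finite),
`∫ f ≤ c.toReal ∫ g`. [folklore] -/
theorem integral_le_of_lintegral_le {X : Type*} [MeasurableSpace X] {μ : Measure X} {f g : X → ℝ} (hf : Measurable f) (hg : Measurable g)
    (hf0 : ∀ x, 0 ≤ f x) (hg0 : ∀ x, 0 ≤ g x) (hgi : Integrable g μ) {c : ℝ≥0∞} (hc : c ≠ ∞)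
    (h : ∫⁻ x, ENNReal.ofReal (f x) ∂μ ≤ c * ∫⁻ x, ENNReal.ofReal (g x) ∂μ) :
    ∫ x, f x ∂μ ≤ c.toReal * ∫ x, g x ∂μ := by
  rw [integral_eq_lintegral_of_nonneg_ae (ae_of_all _ hf0) hf.aestronglyMeasurable,
    integral_eq_lintegral_of_nonneg_ae (ae_of_all _ hg0) hg.aestronglyMeasurable, ← ENNReal.toReal_mul]
  have hfin : ∫⁻ x, ENNReal.ofReal (g x) ∂μ ≠ ∞ :=
    (lintegral_ofReal_ne_top_iff_integrable hg.aestronglyMeasurable (ae_of_all _ hg0)).2 hgi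
  exact ENNReal.toReal_mono (ENNReal.mul_ne_top hc hfin) h

/-- ★ **Domination of a sector event by its own-axis shifted image.**  Let `A, B` be measurable events on `(seam field) × (n+1 slices)` with:
every configuration of `A` has all its plane line holonomies (every slice, every plane site) in the chart shell `exp(ι{a ≤ ‖x‖ ≤ b})`; the shift
`Ψ(g, U⃗) = (g, (ownShift θ U_t)_t)` maps `A` into `B`; and the sector density obeys `w_z ≤ C · w_z ∘ Ψ` on `A`.  Then, with the one-link Jacobian
constant `ρ` of the shell (`sin² r ≤ ρ sin²(r+θ)` on `[a,b]`, `0 < a`, `0 < a + θ`, `b, b + θ < π`),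
`sectorWeight β n z 𝟙_A ≤ C · (ρ^{#plane})^{n+1} · sectorWeight β n z 𝟙_B`. [cite: Luscher1983, §2] [cite: MontvayMunster1994, (3.145)] -/
theorem sectorWeight_indicator_le_of_ownShift (β : ℝ) (n : ℕ) (z : Fin 3 → Bool) {θ a b ρ : ℝ} (ha : 0 < a) (hbπ : b < Real.pi)
    (haθ : 0 < a + θ) (hbθ : b + θ < Real.pi) (hρ : 0 ≤ ρ) (hsin : ∀ r : ℝ, a ≤ r → r ≤ b → Real.sin r ^ 2 ≤ ρ * Real.sin (r + θ) ^ 2)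
    {A B : Set ((Site 3 L → SU2) × (Fin (n + 1) → GaugeConfig 3 L SU2))} (hA : MeasurableSet A) (hB : MeasurableSet B)
    (hAsh : ∀ p ∈ A, ∀ (t : Fin (n + 1)) (x : Site 3 L), x 0 = 0 →
      lineHolonomy (p.2 t) 0 L x ∈ expPoint '' {v : EuclideanSpace ℝ (Fin 3) | a ≤ ‖v‖ ∧ ‖v‖ ≤ b})
    (hAB : ∀ p ∈ A, (p.1, fun t => ownShift θ (p.2 t)) ∈ B) {C : ℝ} (hC : 0 ≤ C)
    (hcost : ∀ p ∈ A, (∏ i : Fin n, transferKernel su2Rep β (p.2 i.castSucc) (p.2 i.succ)) *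
        transferKernel su2Rep β (p.2 (Fin.last n)) (gaugeTransform p.1 (twist3 z (p.2 0))) ≤
      C * ((∏ i : Fin n, transferKernel su2Rep β (ownShift θ (p.2 i.castSucc)) (ownShift θ (p.2 i.succ))) *
        transferKernel su2Rep β (ownShift θ (p.2 (Fin.last n))) (gaugeTransform p.1 (twist3 z (ownShift θ (p.2 0)))))) :
    sectorWeight β n z (fun Us g => A.indicator (fun _ => (1 : ℝ)) (g, Us)) ≤
      C * (ρ ^ (Finset.univ.filter (fun x : Site 3 L => x 0 = 0)).card) ^ (n + 1) *
        sectorWeight β n z (fun Us g => B.indicator (fun _ => (1 : ℝ)) (g, Us)) := by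
  haveI := isProbabilityMeasure_gaugeMeasure (L := L)
  set ν := (gaugeMeasure L).prod (Measure.pi fun _ : Fin (n + 1) => configMeasure SU2 L) with hν
  -- the density and the two integrands
  set w : (Site 3 L → SU2) × (Fin (n + 1) → GaugeConfig 3 L SU2) → ℝ := fun p =>
    (∏ i : Fin n, transferKernel su2Rep β (p.2 i.castSucc) (p.2 i.succ)) *
      transferKernel su2Rep β (p.2 (Fin.last n)) (gaugeTransform p.1 (twist3 z (p.2 0))) with hw
  have hwm : Measurable w := by
    have e : w = (uncurry fun (Us : Fin (n + 1) → GaugeConfig 3 L SU2) (g : Site 3 L → SU2) =>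
        (∏ i : Fin n, transferKernel su2Rep β (Us i.castSucc) (Us i.succ)) *
          transferKernel su2Rep β (Us (Fin.last n)) (gaugeTransform g (twist3 z (Us 0)))) ∘ Prod.swap := by
      funext p; rfl
    rw [e]
    exact (TwoLattice.TowerA.measurable_seamWeight_uncurry (L := L) β z n).comp measurable_swap
  have hw0 : ∀ p, 0 ≤ w p := fun p => seamDensity_nonneg β n z p
  have hwi : Integrable w ν := integrable_seamDensity_swap β n z
  set Ψ : (Site 3 L → SU2) × (Fin (n + 1) → GaugeConfig 3 L SU2) → (Site 3 L → SU2) × (Fin (n + 1) → GaugeConfig 3 L SU2) :=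
    fun p => (p.1, fun t => ownShift θ (p.2 t)) with hΨ
  have hΨm : Measurable Ψ :=
    measurable_fst.prodMk (measurable_pi_lambda _ fun t => (measurable_ownShift θ).comp ((measurable_pi_apply t).comp measurable_snd))
  set fA : (Site 3 L → SU2) × (Fin (n + 1) → GaugeConfig 3 L SU2) → ℝ := A.indicator w with hfA
  set fB : (Site 3 L → SU2) × (Fin (n + 1) → GaugeConfig 3 L SU2) → ℝ := B.indicator w with hfB
  have hfAm : Measurable fA := hwm.indicator hA
  have hfBm : Measurable fB := hwm.indicator hB
  have hfA0 : ∀ p, 0 ≤ fA p := fun p => Set.indicator_nonneg (fun q _ => hw0 q) p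
  have hfB0 : ∀ p, 0 ≤ fB p := fun p => Set.indicator_nonneg (fun q _ => hw0 q) p
  have hfBi : Integrable fB ν := hwi.indicator hB
  -- sector weights as integrals of `fA`, `fB`
  have hWA : sectorWeight β n z (fun Us g => A.indicator (fun _ => (1 : ℝ)) (g, Us)) = ∫ p, fA p ∂ν := by
    rw [sectorWeight_indicator_eq_setIntegral β n z hA, ← integral_indicator hA]
  have hWB : sectorWeight β n z (fun Us g => B.indicator (fun _ => (1 : ℝ)) (g, Us)) = ∫ p, fB p ∂ν := by
    rw [sectorWeight_indicator_eq_setIntegral β n z hB, ← integral_indicator hB]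
  rw [hWA, hWB]
  -- the shell product and the pointwise domination `fA ≤ C · Φ · fB ∘ Ψ`
  set Sh : Set SU2 := expPoint '' {v : EuclideanSpace ℝ (Fin 3) | a ≤ ‖v‖ ∧ ‖v‖ ≤ b} with hSh
  set Φ : (Site 3 L → SU2) × (Fin (n + 1) → GaugeConfig 3 L SU2) → ℝ≥0∞ := fun p =>
    ∏ t : Fin (n + 1), ∏ x ∈ Finset.univ.filter (fun x : Site 3 L => x 0 = 0), Sh.indicator (fun _ => (1 : ℝ≥0∞)) (lineHolonomy (p.2 t) 0 L x) with hΦ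
  have hΦA : ∀ p ∈ A, Φ p = 1 := by
    intro p hp
    refine Finset.prod_eq_one fun t _ => Finset.prod_eq_one fun x hx => ?_
    rw [Set.indicator_of_mem (hAsh p hp t x (Finset.mem_filter.1 hx).2)]
  have hpt : ∀ p, ENNReal.ofReal (fA p) ≤ ENNReal.ofReal C * (Φ p * ENNReal.ofReal (fB (Ψ p))) := by
    intro p
    by_cases hp : p ∈ A
    · rw [hΦA p hp, one_mul, hfA, Set.indicator_of_mem hp, hfB, Set.indicator_of_mem (hAB p hp), ← ENNReal.ofReal_mul hC]
      exact ENNReal.ofReal_le_ofReal (hcost p hp)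
    · rw [hfA, Set.indicator_of_notMem hp, ENNReal.ofReal_zero]
      exact bot_le
  -- the Jacobian inequality on the ring
  have hJ := lintegral_shell_prod_mul_comp_ownShift_slices_le (L := L) ha hbπ haθ hbθ hρ hsin n (fun p => ENNReal.ofReal (fB p))
    hfBm.ennreal_ofReal
  set cJ : ℝ≥0∞ := (ENNReal.ofReal ρ ^ (Finset.univ.filter (fun x : Site 3 L => x 0 = 0)).card) ^ (n + 1) with hcJ
  have hlin : ∫⁻ p, ENNReal.ofReal (fA p) ∂ν ≤ (ENNReal.ofReal C * cJ) * ∫⁻ p, ENNReal.ofReal (fB p) ∂ν := by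
    have hm : Measurable fun p => Φ p * ENNReal.ofReal (fB (Ψ p)) :=
      (Finset.measurable_prod _ fun t _ => Finset.measurable_prod _ fun x _ =>
        (measurable_shellIndicator_lineHolonomy hbπ x).comp ((measurable_pi_apply t).comp measurable_snd)).mul (hfBm.comp hΨm).ennreal_ofReal
    calc ∫⁻ p, ENNReal.ofReal (fA p) ∂ν ≤ ∫⁻ p, ENNReal.ofReal C * (Φ p * ENNReal.ofReal (fB (Ψ p))) ∂ν := lintegral_mono hpt
      _ = ENNReal.ofReal C * ∫⁻ p, Φ p * ENNReal.ofReal (fB (Ψ p)) ∂ν := lintegral_const_mul _ hm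
      _ ≤ ENNReal.ofReal C * (cJ * ∫⁻ p, ENNReal.ofReal (fB p) ∂ν) := mul_le_mul' le_rfl hJ
      _ = (ENNReal.ofReal C * cJ) * ∫⁻ p, ENNReal.ofReal (fB p) ∂ν := by rw [mul_assoc]
  have hcfin : ENNReal.ofReal C * cJ ≠ ∞ :=
    ENNReal.mul_ne_top ENNReal.ofReal_ne_top (ENNReal.pow_ne_top (ENNReal.pow_ne_top ENNReal.ofReal_ne_top))
  have hreal : (ENNReal.ofReal C * cJ).toReal = C * (ρ ^ (Finset.univ.filter (fun x : Site 3 L => x 0 = 0)).card) ^ (n + 1) := by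
    rw [ENNReal.toReal_mul, ENNReal.toReal_ofReal hC, hcJ, ENNReal.toReal_pow, ENNReal.toReal_pow, ENNReal.toReal_ofReal hρ]
  have h := integral_le_of_lintegral_le hfAm hfBm hfA0 hfB0 hfBi hcfin hlin
  rwa [hreal] at h

end Summit.QuantumFields.YangMills.Theorems.FemtoTransferGap.OwnAxis

end
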